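/-
Copyright (c) 2026 the pub-hodgecm-mathlib formalisation cell (harness21).  Prover seat hodgecm-mathlib-K2E1-p11 (g2), Track B ∕ K2-LIT, h413 =
`stmt-HodgeConjecture-24833`, line `K2_E1_TraceFormulaBeta`, campaign «EIS-R7-BL-SPH-3» ∕ R8-LADDER-3, «MS-3» — (MS-P) OFF THE REAL AXIS AT `N = 3` (dealer K2E1-plan (g7) (138);
K2E4-p10 (g6)'s consumer shape 2026-09-04T11:43:59Z; this seat's «=∕≠» 11:58Z): the DIAGONAL Maass–Selberg identity `‖F z‖² = R(z, z; c̃)` on the per-ball holomorphy domain, the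
resulting local `L²`-boundedness of the truncated family near every NON-REAL point where the scalar `c̃` is bounded, and its LETTER-FREE instantiation for `U(2,1)∕CM` from ★
`poleExclusion_package_cm_three` ((a2) bounds `cI`) and ★ CLOSER₃.
-/
import Summits.HodgeConjecture.HodgeConjecture.Theorems.K2E1SphericalEisensteinPoleExclusionCMThreeFinal   -- ★ p859858 (this seat): `poleExclusion_package_cm_three` (X2b₃ re-exported ∧ (MS)); brings ★ p859741, ★ CLOSER₃ p859662, ★ `_on'`₃ p859698, ★ p859595
import Summits.HodgeConjecture.HodgeConjecture.Theorems.K2E1MaassSelbergDiagonalFourTermCMThree          -- ★∕📤 (this seat): `normSq_family_eq_fourTerm_on'`, `norm_family_le_of_scalar_bound_on'`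
import HarnessLib

/-!
# h413 ∕ Track B «K2-LIT», «MS-3» — `K2E1SphericalEisensteinL2BoundOffAxisCMThree`: (MS-P) OFF THE REAL AXIS, LETTER-FREE — the per-ball truncated Eisenstein family of `U(2,1)∕CM`
# is `L²`-bounded near every non-real point of `D⁺ ∩ D_{m+1}`

Cell `pub/hodgecm-mathlib`, crux H413 = `stmt-HodgeConjecture-24833`, route `HCCMUnconditional`; dealer K2E1-plan (g7) ruling (138) («deliver (γ) as named corollaries … off-axis z₀
directly; real z₀ … no silent gap»); consumer K2E4-p10 (g6) capstone₃ ((MS-P) shape, 11:43:59Z).  THEOREMS ONLY (no `def` ∕ `instance` ∕ `notation` ∕ named-fact hypothesis ∕ `sorry`;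
default heartbeats); lane `--kind proof --supports stmt-HodgeConjecture-24833 --as helper` (count-neutral; closes no socket).
THE MATHEMATICS [MoeglinWaldspurger1995, IV.2.3, IV.3.12 (a); Arthur1980TraceFormulaII, §4].  The continued Maass–Selberg relation identifies the pairing `⟪Λ^TẼ(z′), Λ^TẼ(z)⟫` with the
four-term `R(z, z′; c̃)` on the sub-tube, hence (identity theorem in `(z, w = conj z′)` on `D₁ × conj⁻¹D₁`) everywhere on `D₁ × D₁`; on the DIAGONAL this reads
`‖Λ^TẼ(z)‖² = R(z, z; c̃(z))` (§1 — the step the ★ `_on'` editions keep internal).  The right side is a continuous function of `(z, c̃(z))` as long as `Re z > 1` and `Im z ≠ 0` (denominators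
`2(Re z − 1)`, `2i·Im z`), so wherever `c̃` stays bounded near a NON-REAL `z₀ ∈ D⁺` the family stays `L²`-bounded (§2, continuity + compactness — no explicit constant).  With the pole-exclusion
bound (a2) of ★ `poleExclusion_package_cm_three` for `c̃ = cI` (uniform on `Re z − 1 ∈ [x₀∕2, 3x₀∕2]`, `|Im z| ≥ y₀∕2`) this gives §3: the per-ball family of ★ CLOSER₃ is `L²`-bounded near
every non-real `z₀ ∈ D⁺ ∩ D_{m+1}` — (MS-P) off the real axis, letter-free.  NOT covered, and said so: REAL `z₀ ∈ (1, ∞)` and the `(z − 2)`-weighted bound (MS-2) at `z₀ = 2` (the bounds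
carry `1∕|Im z|`); those remain the capstone's visible `hMSreal` letters.
* (§1∕§2 = ★ `K2E1MaassSelbergDiagonalFourTermCMThree`: `normSq_family_eq_fourTerm_on'`, `norm_family_le_of_scalar_bound_on'`.)
* §3 **`msP_offAxis_cm_three`** — (MS-P) off the real axis, LETTER-FREE (structural measures, compact∕idelic package, `φ₀ ≠ 0`).
HONEST LABEL.  Count-neutral helper; proves no printed statement; HC_CM is proved only modulo the 7 printed citations (2 remaining named inputs: hLiu418 = `stmt-HodgeConjecture-24832`, h413 =
`stmt-HodgeConjecture-24833`) until rung 0 closes.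

## References
* [MoeglinWaldspurger1995] C. Mœglin, J.-L. Waldspurger, *Spectral decomposition and Eisenstein series* (1995), IV.1.11, IV.2.3, IV.3.12 (a).
* [Arthur1980TraceFormulaII] J. Arthur, *A trace formula for reductive groups II*, Compositio Math. 40 (1980), §4.
* [BernsteinLapid2019] J. Bernstein, E. Lapid, *On the meromorphic continuation of Eisenstein series*, J. AMS 37 (2024), Thm 2.3, §4.
-/

set_option autoImplicit false
-- the mandated namespace repeats `HodgeConjecture.HodgeConjecture`, as in every `Theorems/*.lean` of this sub-problem
set_option linter.dupNamespace false

noncomputable section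

open MeasureTheory MeasureTheory.Measure Set NumberField IsDedekindDomain Filter Topology Metric
open scoped NNReal ENNReal ComplexConjugate InnerProductSpace
open Literature.MeasureTheory.Group Literature.NumberTheory
open Literature.NumberTheory.Automorphic Literature.NumberTheory.Automorphic.UnitaryGroup AdelicGroupData
open Summit.HodgeConjecture.HodgeConjecture.Cruxes.H413.K2E1BorelEisensteinU
open Summit.HodgeConjecture.HodgeConjecture.Cruxes.H413.K2E1BLBorelSpacesU2Defs
open Summit.HodgeConjecture.HodgeConjecture.Cruxes.H413.K2E1BLBorelOperatorsU2Defs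
open Summit.HodgeConjecture.HodgeConjecture.Cruxes.H413.K2E1MaassSelbergContinuedCMThree (add_sub_two_ne_zero_and_sub_ne_zero)
open Summit.HodgeConjecture.HodgeConjecture.Cruxes.H413.K2E1MaassSelbergSphericalBracketsCMThree (measureReal_maximalCompact_pos idelicBracket_pos)
open Summit.HodgeConjecture.HodgeConjecture.Cruxes.H413.K2E1MaassSelbergFamilyCMThree (exists_truncatedFamily_cm_three)
open Summit.HodgeConjecture.HodgeConjecture.Cruxes.H413.K2E1ConvexDiffCountableConnected (isPreconnected_convex_diff_of_countable countable_of_codiscrete)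
open Summit.HodgeConjecture.HodgeConjecture.Cruxes.H413.K2E1SphericalEisensteinPoleExclusionCMThree (countable_ball_diff_of_codiscrete)
open Summit.HodgeConjecture.HodgeConjecture.Cruxes.H413.K2E1SphericalEisensteinPoleExclusionCMThreeFinal (poleExclusion_package_cm_three)

open Summit.HodgeConjecture.HodgeConjecture.Cruxes.H413.K2E1MaassSelbergDiagonalFourTermCMThree (norm_family_le_of_scalar_bound_on')

namespace Summit.HodgeConjecture.HodgeConjecture.Cruxes.H413.K2E1SphericalEisensteinL2BoundOffAxisCMThree

section Family

variable (L : Type) [Field L] [NumberField L] [IsCMField L]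
variable [MeasurableSpace (quasiSplit (↥(maximalRealSubfield L)) L (IsCMField.complexConj L) 3).Adelic] [BorelSpace (quasiSplit (↥(maximalRealSubfield L)) L (IsCMField.complexConj L) 3).Adelic]
variable [MeasurableSpace (AdeleRing (𝓞 L) L)ˣ] [BorelSpace (AdeleRing (𝓞 L) L)ˣ]

/-! ## §3 (MS-P) OFF THE REAL AXIS, LETTER-FREE: the per-ball family of `U(2,1)∕CM` is `L²`-bounded near every non-real point of `D⁺ ∩ D_{m+1}` -/

/-- **(MS-P) OFF THE REAL AXIS AT `N = 3`, LETTER-FREE** (K2E4-p10 (g6)'s consumer shape of 2026-09-04T11:43:59Z, at ONE level and on the per-ball domain — this seat's «=∕≠» 11:58Z).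
For the CM pair, the structural measures (`ν 𝓕 = 1`), the compact∕idelic package and `φ₀ ≠ 0`: for every ball index `m ≥ 2` there are a level `T₀ ≥ 1`, an OPEN PRECONNECTED
`D₂ ⊆ D⁺ = {1 < Re, 0 < Im}` (namely `(D⁺ ∩ D_{m+1} ∩ U m) ∖ P` of ★ `poleExclusion_package_cm_three`) containing an open non-empty piece of the tube `{2 < Re}`, and an
`L²(𝔛, μ)`-valued `F₂` holomorphic on `D₂` with `F₂ z = [quotFun (Λ^{T₀} E(φ₀H^z))]` on `D₂ ∩ {2 < Re}`, such that for EVERY non-real `z₀ ∈ D⁺ ∩ D_{m+1}` (pole or not):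
`z ∈ D₂` for `z` near `z₀` (punctured), and `‖F₂ z‖ ≤ C` there.  Proof: ★ package ((a2) bounds `cI` near `z₀`, uniformly since `Re z − 1 ∈ [x₀∕2, 3x₀∕2]`, `|Im z| ≥ y₀∕2` there)
∘ ★ CLOSER₃ (the family) ∘ §2.  NOT covered (visible letters for the capstone): real `z₀` and the `(z − 2)`-weighted bound at `z₀ = 2`.
[cite: MoeglinWaldspurger1995, IV.1.11, IV.3.12 (a)] [cite: BernsteinLapid2019, Thm 2.3, §4] -/
theorem msP_offAxis_cm_three
    -- structural letters: the measures (verbatim as FILE X1₃ ∕ ★ X2₃ core ∕ ★ closer₃)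
    (μ : Measure (quasiSplit (↥(maximalRealSubfield L)) L (IsCMField.complexConj L) 3).automorphicQuotient) [(quasiSplit (↥(maximalRealSubfield L)) L (IsCMField.complexConj L) 3).IsAutomorphicMeasure μ]
    (νG : Measure (quasiSplit (↥(maximalRealSubfield L)) L (IsCMField.complexConj L) 3).Adelic) [νG.IsHaarMeasure] [νG.IsInvInvariant] [SFinite νG]
    (ν : Measure ↥(adelicUnipotent (↥(maximalRealSubfield L)) L (IsCMField.complexConj L) 3)) [ν.IsHaarMeasure] [ν.IsMulRightInvariant] [ν.IsInvInvariant]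
    {𝓕 : Set ↥(adelicUnipotent (↥(maximalRealSubfield L)) L (IsCMField.complexConj L) 3)}
    (h𝓕N : IsFundamentalDomain ↥(rationalUnipotent (↥(maximalRealSubfield L)) L (IsCMField.complexConj L) 3) 𝓕 ν) (h𝓕c : IsCompact (closure 𝓕)) (h𝓕1 : ν 𝓕 = 1)
    {β : (quasiSplit (↥(maximalRealSubfield L)) L (IsCMField.complexConj L) 3).Adelic → ℝ≥0∞}
    (hβ : IsCoveringWeight ↥((arithmeticBorel (↥(maximalRealSubfield L)) L (IsCMField.complexConj L) 3).map (quasiSplit (↥(maximalRealSubfield L)) L (IsCMField.complexConj L) 3).arithmeticSubgroup.subtype) β)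
    {μZ : Measure (borelQuotient (↥(maximalRealSubfield L)) L (IsCMField.complexConj L) 3)} [SFinite μZ]
    (hμZ : ∀ f : borelQuotient (↥(maximalRealSubfield L)) L (IsCMField.complexConj L) 3 → ℝ≥0∞, Measurable f → ∫⁻ z, f z ∂μZ = ∫⁻ g, β g * f (toBorelQuotient (↥(maximalRealSubfield L)) L (IsCMField.complexConj L) 3 g) ∂νG)
        -- the compact ∕ idelic package of ★ p859379
    (μK : Measure ((standardMaximalCompactGL 3 L).comap (adelicVal (↥(maximalRealSubfield L)) L (IsCMField.complexConj L) 3 ((StdForm.antidiagonal 3).over L)) : Subgroup (quasiSplit (↥(maximalRealSubfield L)) L (IsCMField.complexConj L) 3).Adelic))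
    [μK.IsHaarMeasure]
    (νI : Measure (AdeleRing (𝓞 L) L)ˣ) [νI.IsHaarMeasure]
    {𝓕I : Set (AdeleRing (𝓞 L) L)ˣ} (h𝓕I : IsIdeleClassDomain L 𝓕I)
    {φ₀ : ℂ} (hφ₀ : φ₀ ≠ 0)
    (m : ℕ) (hm : 2 ≤ m) :
    ∃ T₀ : ℝ≥0, 1 ≤ T₀ ∧ ∃ D₂ : Set ℂ, IsOpen D₂ ∧ IsPreconnected D₂ ∧ D₂ ⊆ {z : ℂ | 1 < z.re ∧ 0 < z.im} ∧
      (∃ O : Set ℂ, IsOpen O ∧ O.Nonempty ∧ O ⊆ D₂ ∩ {z : ℂ | 2 < z.re}) ∧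
      ∃ F₂ : ℂ → Lp ℂ 2 μ, DifferentiableOn ℂ F₂ D₂ ∧
        (∀ z ∈ D₂, 2 < z.re → ((F₂ z : Lp ℂ 2 μ) : (quasiSplit (↥(maximalRealSubfield L)) L (IsCMField.complexConj L) 3).automorphicQuotient → ℂ) =ᵐ[μ]
          (quasiSplit (↥(maximalRealSubfield L)) L (IsCMField.complexConj L) 3).quotFun (truncation ν 𝓕 T₀ (eisensteinSeriesU (flatSectionU (fun _ : (quasiSplit (↥(maximalRealSubfield L)) L (IsCMField.complexConj L) 3).Adelic => φ₀) z)))) ∧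
        ∀ z₀ ∈ Metric.ball (0 : ℂ) (((m + 1 : ℕ) : ℝ) + 2), 1 < z₀.re → 0 < z₀.im →
          (∀ᶠ z in 𝓝[≠] z₀, z ∈ D₂) ∧ ∃ C : ℝ, ∀ᶠ z in 𝓝[≠] z₀, z ∈ D₂ → ‖F₂ z‖ ≤ C := by
  have h𝓕₀ : ν 𝓕 ≠ 0 := by rw [h𝓕1]; exact one_ne_zero
  have hκr : 0 < (∫ x in {x : (AdeleRing (𝓞 L) L)ˣ | (IdeleClassGroup.ideleNorm L x : ℝ) ≤ 1} ∩ 𝓕I, (IdeleClassGroup.ideleNorm L x : ℝ) ∂νI) := idelicBracket_pos νI h𝓕I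
  have hmK : 0 < μK.real Set.univ := measureReal_maximalCompact_pos μK
  obtain ⟨Ec, P, cI, I, hI, η, h, a, κ, T, U, vX, cc, -, hEcE, hPc, hPcd, -, -, -, -, -, -, hcan, hcc, -, hballs, hMS⟩ :=
    poleExclusion_package_cm_three L μ νG ν h𝓕N h𝓕c h𝓕1 hβ hμZ μK νI h𝓕I hφ₀
  obtain ⟨hR1, hdef, hreg, hcov, ha, hκ, hΩ, hTX, hUo, hUD, -, hUcod, hvXd, -, -, -, -, -, hE5⟩ := hballs m
  -- the family on `U m ∖ P` (★ CLOSER₃)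
  obtain ⟨T₀, hT₀, Fam, hFd, hFam⟩ := exists_truncatedFamily_cm_three L μ νG ν h𝓕N h𝓕c h𝓕₀ hβ hμZ (m + 1) (η m) (h m) (a m) (κ m) (T m) (U m) (vX m)
    (fun i => (hR1 i).1) hdef (fun i => ⟨(hreg i).1, (hreg i).2.1⟩) hcov ha hκ hΩ hTX hUo hUD hvXd Ec P hE5
  -- the domain `D₁ = C ∖ S`
  set D₁ : Set ℂ := ({z : ℂ | 1 < z.re ∧ 0 < z.im} ∩ Metric.ball (0 : ℂ) (((m + 1 : ℕ) : ℝ) + 2) ∩ U m) \ P with hD₁def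
  set C : Set ℂ := {z : ℂ | 1 < z.re ∧ 0 < z.im} ∩ Metric.ball (0 : ℂ) (((m + 1 : ℕ) : ℝ) + 2) with hCdef
  set S : Set ℂ := (Metric.ball (0 : ℂ) (((m + 1 : ℕ) : ℝ) + 2) \ U m) ∪ P with hSdef
  have hQo : IsOpen {z : ℂ | 1 < z.re ∧ 0 < z.im} := (isOpen_lt continuous_const Complex.continuous_re).inter (isOpen_lt continuous_const Complex.continuous_im)
  have hCo : IsOpen C := hQo.inter Metric.isOpen_ball
  have hCc : Convex ℝ C := ((convex_halfSpace_re_gt 1).inter (convex_halfSpace_im_gt 0)).inter (convex_ball (0 : ℂ) _)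
  have hSc : S.Countable := (countable_ball_diff_of_codiscrete hUcod).union (countable_of_codiscrete hPcd)
  have hDCS : D₁ = C \ S := by
    ext z
    simp only [hD₁def, hCdef, hSdef, Set.mem_sdiff, Set.mem_inter_iff, Set.mem_union, not_or, not_and, not_not]
    constructor
    · rintro ⟨⟨⟨hq, hb⟩, hU⟩, hP⟩
      exact ⟨⟨hq, hb⟩, fun _ => hU, hP⟩
    · rintro ⟨⟨hq, hb⟩, hU, hP⟩
      exact ⟨⟨⟨hq, hb⟩, hU hb⟩, hP⟩
  have hD₁o : IsOpen D₁ := (hCo.inter hUo).sdiff hPc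
  have hD₁c : IsPreconnected D₁ := by
    rw [hDCS]
    exact isPreconnected_convex_diff_of_countable Literature.Topology.Euclidean.one_lt_rank_real_complex hCc hCo hSc
  have hD₁sub : D₁ ⊆ {z : ℂ | 1 < z.re ∧ 0 < z.im} := fun z hz => hz.1.1.1
  have hD₁UP : D₁ ⊆ U m \ P := fun z hz => ⟨hz.1.2, hz.2⟩
  -- the boxes
  have hm' : (2 : ℝ) ≤ m := by exact_mod_cast hm
  have hdense : Dense Sᶜ := hSc.dense_compl ℝ
  have hbox : ∀ (a b : ℝ) (w : ℂ), a < w.re → w.re < b → 0 < w.im → w.im < 1 → 1 < w.re → ‖w‖ < (((m + 1 : ℕ) : ℝ) + 2) →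
      IsOpen (D₁ ∩ {z : ℂ | (a < z.re ∧ z.re < b) ∧ (0 < z.im ∧ z.im < 1)}) ∧ (D₁ ∩ {z : ℂ | (a < z.re ∧ z.re < b) ∧ (0 < z.im ∧ z.im < 1)}).Nonempty := by
    intro a b w h1 h2 h3 h4 h5 h6
    have hBo : IsOpen {z : ℂ | (a < z.re ∧ z.re < b) ∧ (0 < z.im ∧ z.im < 1)} :=
      ((isOpen_lt continuous_const Complex.continuous_re).inter (isOpen_lt Complex.continuous_re continuous_const)).inter
        ((isOpen_lt continuous_const Complex.continuous_im).inter (isOpen_lt Complex.continuous_im continuous_const))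
    refine ⟨hD₁o.inter hBo, ?_⟩
    have hwC : w ∈ C ∩ {z : ℂ | (a < z.re ∧ z.re < b) ∧ (0 < z.im ∧ z.im < 1)} := ⟨⟨⟨h5, h3⟩, mem_ball_zero_iff.2 h6⟩, ⟨h1, h2⟩, ⟨h3, h4⟩⟩
    obtain ⟨z, ⟨hzC, hzB⟩, hzS⟩ := hdense.inter_open_nonempty _ (hCo.inter hBo) ⟨w, hwC⟩
    refine ⟨z, ⟨?_, hzB⟩⟩
    rw [hDCS]
    exact ⟨hzC, hzS⟩
  have hcast : (((m + 1 : ℕ) : ℝ) + 2) = (m : ℝ) + 3 := by push_cast; ring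
  have hw₁ : ‖(⟨41 / 10, 1 / 10⟩ : ℂ)‖ < (((m + 1 : ℕ) : ℝ) + 2) :=
    lt_of_le_of_lt (Complex.norm_le_abs_re_add_abs_im _) (by rw [hcast]; norm_num [abs_of_pos]; linarith)
  have hw₂ : ‖(⟨21 / 10, 1 / 10⟩ : ℂ)‖ < (((m + 1 : ℕ) : ℝ) + 2) :=
    lt_of_le_of_lt (Complex.norm_le_abs_re_add_abs_im _) (by rw [hcast]; norm_num [abs_of_pos]; linarith)
  obtain ⟨hO₁o, hO₁ne⟩ := hbox 4 5 ⟨41 / 10, 1 / 10⟩ (by norm_num) (by norm_num) (by norm_num) (by norm_num) (by norm_num) hw₁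
  obtain ⟨hO₂o, hO₂ne⟩ := hbox 2 3 ⟨21 / 10, 1 / 10⟩ (by norm_num) (by norm_num) (by norm_num) (by norm_num) (by norm_num) hw₂
  have hsep : ∀ z ∈ D₁ ∩ {z : ℂ | (4 < z.re ∧ z.re < 5) ∧ (0 < z.im ∧ z.im < 1)}, ∀ z' ∈ D₁ ∩ {z : ℂ | (2 < z.re ∧ z.re < 3) ∧ (0 < z.im ∧ z.im < 1)}, 2 < z'.re ∧ z'.re < z.re :=
    fun z hz z' hz' => ⟨hz'.2.1.1, by linarith [hz'.2.1.2, hz.2.1.1]⟩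
  -- the scalar `cI` on `D₁`, the family on `D₁`
  have hc : DifferentiableOn ℂ cI D₁ := fun z hz => (hcan z hz.2).differentiableAt.differentiableWithinAt
  have hceq : ∀ z : ℂ, 2 < z.re → cI z = (∫ v : ↥(adelicUnipotent (↥(maximalRealSubfield L)) L (IsCMField.complexConj L) 3), (((borelHeight ((quasiSplit (↥(maximalRealSubfield L)) L (IsCMField.complexConj L) 3).toAdelic (weylLongU ((IsCMField.complexConj L : L ≃ₐ[↥(maximalRealSubfield L)] L) : L →+* L) (rfl : (StdForm.antidiagonal 3).over L = (StdForm.antidiagonal 3).over L)) * (v : (quasiSplit (↥(maximalRealSubfield L)) L (IsCMField.complexConj L) 3).Adelic))) : ℝ) : ℂ) ^ z ∂ν) := by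
    intro z hz
    rw [hcc z hz, h𝓕1, ENNReal.toReal_one, inv_one, Complex.ofReal_one, one_mul]
  have hFd₁ : DifferentiableOn ℂ Fam D₁ := hFd.mono hD₁UP
  have hFtube : ∀ z ∈ D₁, 2 < z.re → ((Fam z : Lp ℂ 2 μ) : (quasiSplit (↥(maximalRealSubfield L)) L (IsCMField.complexConj L) 3).automorphicQuotient → ℂ) =ᵐ[μ]
      (quasiSplit (↥(maximalRealSubfield L)) L (IsCMField.complexConj L) 3).quotFun (truncation ν 𝓕 T₀ (eisensteinSeriesU (flatSectionU (fun _ : (quasiSplit (↥(maximalRealSubfield L)) L (IsCMField.complexConj L) 3).Adelic => φ₀) z))) := by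
    intro z hz hz2
    rw [← hEcE z hz2]
    exact hFam z (hD₁UP hz)
  refine ⟨T₀, hT₀, D₁, hD₁o, hD₁c, hD₁sub, ⟨_, hO₂o, hO₂ne, fun z hz => ⟨hz.1, hz.2.1.1⟩⟩, Fam, hFd₁, hFtube, fun z₀ hz₀b hz₀re hz₀im => ⟨?_, ?_⟩⟩
  · -- near `z₀` one is in `D₁` (co-discreteness of `P` and of `D_{m+1} ∖ U m`)
    have h1 : ∀ᶠ z in 𝓝[≠] z₀, z ∈ C := mem_nhdsWithin_of_mem_nhds (hCo.mem_nhds ⟨⟨hz₀re, hz₀im⟩, hz₀b⟩)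
    filter_upwards [h1, hPcd z₀, hUcod z₀ hz₀b] with z hzC hzP hzU
    exact ⟨⟨hzC, hzU⟩, hzP⟩
  · -- the bound: (a2) for `cI` near `z₀`, then §2
    obtain ⟨T₁, -, hMS1⟩ := hMS m hm
    set x₀ : ℝ := z₀.re - 1 with hx₀
    set y₀ : ℝ := z₀.im with hy₀
    have hx₀0 : 0 < x₀ := by rw [hx₀]; linarith
    have hy₀0 : 0 < y₀ := hz₀im
    obtain ⟨B, hB⟩ : ∃ B : ℝ, ∀ z ∈ D₁, x₀ / 2 ≤ z.re - 1 → z.re - 1 ≤ 3 * x₀ / 2 → y₀ / 2 ≤ |z.im| →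
        (∫ x in {x : (AdeleRing (𝓞 L) L)ˣ | (IdeleClassGroup.ideleNorm L x : ℝ) ≤ 1} ∩ 𝓕I, (IdeleClassGroup.ideleNorm L x : ℝ) ∂νI) * μK.real Set.univ * ‖cI z‖ ^ 2 * ‖φ₀‖ ^ 2 ≤ B ^ 2 :=
      ⟨_, fun z hz h1 h2 h3 => (hMS1 z hz).2.1 (by linarith) ⟨h1, h2⟩ (by linarith) h3⟩
    set P₀ : ℝ := (∫ x in {x : (AdeleRing (𝓞 L) L)ˣ | (IdeleClassGroup.ideleNorm L x : ℝ) ≤ 1} ∩ 𝓕I, (IdeleClassGroup.ideleNorm L x : ℝ) ∂νI) * μK.real Set.univ * ‖φ₀‖ ^ 2 with hP₀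
    have hP₀0 : 0 < P₀ := by rw [hP₀]; exact mul_pos (mul_pos hκr hmK) (pow_pos (norm_pos_iff.2 hφ₀) 2)
    have hρ : 0 < min (x₀ / 2) (y₀ / 2) := lt_min (by linarith) (by linarith)
    have hball : ∀ᶠ z in 𝓝[≠] z₀, z ∈ Metric.ball z₀ (min (x₀ / 2) (y₀ / 2)) := mem_nhdsWithin_of_mem_nhds (Metric.ball_mem_nhds z₀ hρ)
    have hcb : ∀ᶠ z in 𝓝[≠] z₀, z ∈ D₁ → ‖cI z‖ ≤ Real.sqrt (B ^ 2 / P₀) := by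
      filter_upwards [hball] with z hz hzD
      have hd : ‖z - z₀‖ < min (x₀ / 2) (y₀ / 2) := mem_ball_iff_norm.1 hz
      have hre : |z.re - z₀.re| < x₀ / 2 := by
        have h := Complex.abs_re_le_norm (z - z₀); rw [Complex.sub_re] at h; exact h.trans_lt (hd.trans_le (min_le_left _ _))
      have him : |z.im - z₀.im| < y₀ / 2 := by
        have h := Complex.abs_im_le_norm (z - z₀); rw [Complex.sub_im] at h; exact h.trans_lt (hd.trans_le (min_le_right _ _))
      have h1 : x₀ / 2 ≤ z.re - 1 := by rw [hx₀] at hre ⊢; linarith [(abs_lt.1 hre).1]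
      have h2 : z.re - 1 ≤ 3 * x₀ / 2 := by rw [hx₀] at hre ⊢; linarith [(abs_lt.1 hre).2]
      have h3 : y₀ / 2 ≤ |z.im| := by
        rw [hy₀] at him ⊢
        have : z₀.im / 2 ≤ z.im := by linarith [(abs_lt.1 him).1]
        exact this.trans (le_abs_self _)
      have hsq : ‖cI z‖ ^ 2 ≤ B ^ 2 / P₀ := by
        rw [le_div_iff₀ hP₀0]
        calc ‖cI z‖ ^ 2 * P₀ = (∫ x in {x : (AdeleRing (𝓞 L) L)ˣ | (IdeleClassGroup.ideleNorm L x : ℝ) ≤ 1} ∩ 𝓕I, (IdeleClassGroup.ideleNorm L x : ℝ) ∂νI) * μK.real Set.univ * ‖cI z‖ ^ 2 * ‖φ₀‖ ^ 2 := by rw [hP₀]; ring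
          _ ≤ B ^ 2 := hB z hzD h1 h2 h3
      calc ‖cI z‖ = Real.sqrt (‖cI z‖ ^ 2) := (Real.sqrt_sq (norm_nonneg _)).symm
        _ ≤ Real.sqrt (B ^ 2 / P₀) := Real.sqrt_le_sqrt hsq
    exact norm_family_le_of_scalar_bound_on' L hD₁o hD₁c hD₁sub hO₁o hO₁ne Set.inter_subset_left hO₂o hO₂ne Set.inter_subset_left hsep
      μ νG μK νI h𝓕I ν h𝓕N h𝓕1 h𝓕c hT₀ hβ hc hceq Fam hFd₁ hFtube ⟨hz₀re, hz₀im⟩ hcb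

end Family

end Summit.HodgeConjecture.HodgeConjecture.Cruxes.H413.K2E1SphericalEisensteinL2BoundOffAxisCMThree

end
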